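import Summits.MatrixMultiplication.OmegaCensus.STPPSmallPatternT2K15LinkSeedsA
import Summits.MatrixMultiplication.OmegaCensus.STPPSmallPatternT2K15LinkSeedsB
import Summits.MatrixMultiplication.OmegaCensus.STPPSmallPatternT2K15ProdSeedsM
import Summits.MatrixMultiplication.OmegaCensus.STPP222CubeFrom46

/-!
# ω-census, `(1,2,2)¹⁵` WINDOW law «order in [316, 320]»: every window seed type is an EXCEPTION or HOSTS (dispatch; kernel)

HONEST FRAMING (pub-omega census; verbatim): lottery ticket; floor = certified bounds/negative ranges.
Census STRUCTURE bookkeeping of the STPP track (seat pub-omega-stpp-3, gen 28; STRUCTURE row B5, column `T2`, §2 C10 row 15), not progress on `ω`: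
small patterns in small groups bound no exponent.

The 11 window seed types (seed types of the `316` plan of order `≤ 320`): 3 exception(s) (`ℤ/8 × ℤ/8 × ℤ/5`, `ℤ/5 × ℤ/4 × ℤ/4 × ℤ/4` and `ℤ/5 × (ℤ/2)⁶` (all of order `320`; the three seed types of the `316` plan without a known `(1,2,2)¹⁵` family — desk + kit GO #158 random-restart searches blank, no NONE claimed)) — no family is claimed for them — and
8 hosts by theorems already in the tree (product-route types `…T2K15ProdSeeds*` (incl. the order-32-host / CRT block ones of `…ProdSeedsM`), desk witnesses and T1 rays `…T2K15LinkSeedsA`, kit GO #158 finds `…T2K15LinkSeedsB`).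

References: H. Cohn, R. Kleinberg, B. Szegedy, C. Umans, FOCS 2005 (arXiv:math/0511460), Def. 5.1.
-/

open Literature.Computability.AlgebraicComplexity Finset

namespace Summit.MatrixMultiplication.OmegaCensus

set_option maxRecDepth 20000 in
/-- Every one of the 11 window seed types is one of the exception types `[[8, 8, 5], [5, 4, 4, 4], [5, 2, 2, 2, 2, 2, 2]]` or hosts `(1,2,2)¹⁵` (one nested `List.forall_mem_cons` term over landed seed
theorems). [cite: CohnKleinbergSzegedyUmans2005, Def. 5.1] -/
theorem mem_exc_or_exists_122pow15_of_mem_windowSeedsT2K15W316 : ∀ s ∈ ([[79, 2, 2], [8, 8, 5], [16, 5, 4], [32, 5, 2], [5, 4, 4, 4], [8, 5, 4, 2], [16, 5, 2, 2], [5, 4, 4, 2, 2], [8, 5, 2, 2, 2], [5, 4, 2, 2, 2, 2], [5, 2, 2, 2, 2, 2, 2]] : List (List ℕ)), s ∈ ([[8, 8, 5], [5, 4, 4, 4], [5, 2, 2, 2, 2, 2, 2]] : List (List ℕ)) ∨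
    ∃ A B C : Fin 15 → Finset (SeedType s), IsSTPP A B C ∧ ∀ i, (A i).card = 1 ∧ (B i).card = 2 ∧ (C i).card = 2 :=
  List.forall_mem_cons.2 ⟨Or.inr exists_isSTPP_122pow15_seed_79_2_2, List.forall_mem_cons.2 ⟨Or.inl (by decide), List.forall_mem_cons.2 ⟨Or.inr exists_isSTPP_122pow15_seed_16_5_4, List.forall_mem_cons.2 ⟨Or.inr exists_isSTPP_122pow15_seed_32_5_2, List.forall_mem_cons.2 ⟨Or.inl (by decide), List.forall_mem_cons.2 ⟨Or.inr exists_isSTPP_122pow15_seed_8_5_4_2, List.forall_mem_cons.2 ⟨Or.inr exists_isSTPP_122pow15_seed_16_5_2_2, List.forall_mem_cons.2 ⟨Or.inr exists_isSTPP_122pow15_seed_5_4_4_2_2, List.forall_mem_cons.2 ⟨Or.inr exists_isSTPP_122pow15_seed_8_5_2_2_2, List.forall_mem_cons.2 ⟨Or.inr exists_isSTPP_122pow15_seed_5_4_2_2_2_2, List.forall_mem_cons.2 ⟨Or.inl (by decide), List.forall_mem_nil _⟩⟩⟩⟩⟩⟩⟩⟩⟩⟩⟩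

end Summit.MatrixMultiplication.OmegaCensus
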